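import Summits.QuantumFields.YangMills.Theorems.RevelationMartingaleFreshVertexZeroIncrementT3
import Summits.QuantumFields.YangMills.Theorems.UnitScaleGibbsAxialGaugeCondSD
import Summits.QuantumFields.YangMills.Theorems.FradkinShenkerFlowFiniteSusceptibilityWeakCouplingSU2ConjugationEven
import Summits.QuantumFields.YangMills.Theorems.UnitScaleGibbsWordTwoElitzur
import HarnessLib

/-!
# Elitzur orthogonality for Bałaban's Wilson–Gibbs measure: a RAW first-insertion word is `μ_β`-orthogonal to every observable blind to the
# gauge rotations at its insertion vertex — by the PAULI TWIRL (four site rotations), no Haar average, every `β`, every volume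

Cell `ym3-torus` (YM ladder rung R3 = continuum SU(2) Yang–Mills on T³ — a RUNG, NOT the Clay problem: not d = 4, not infinite volume, not a mass gap);
TWIN-WIDTH helper seat `ym-ust-19936-w8` g10; def-free, 0 `sorry`, default heartbeats.  Row (E1) of this seat's FINDING
`FINDING-ELITZUR-GLOBALV-w8g10.md` (stmt-QuantumFields-23083 evidence #4) for the repair of LINE 28's identification step (★★OWNER WORD 39 (3));
row (E2) (double-insertion words) is ym3-torus-px17 g7's `UnitScaleGibbsWordTwoElitzur`, which imports §1–§3 of this file.  Used BY NAME:
✓`RevelationMartingaleTreeGauge.measurePreserving_gaugeAct_gibbsMeasure` (the Wilson–Gibbs law is gauge invariant; w4 g9),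
px17's slot calculus ✓`UnitScaleGibbsActionDerivativeSlotCalculus` (`slotBond`, `slot`, `slotIns`, `word`).

THE MECHANISM (S. Elitzur 1975; M. Creutz, Quarks, Gluons and Lattices, Ch. 9).  `μ_β = Z⁻¹e^{−βA}dU` is invariant under every gauge transformation, in
particular under the four SITE ROTATIONS at a vertex `y` by the unit quaternions `{1, 𝐢, 𝐣, 𝐤} ⊂ SU(2)`.  A first-insertion word of the slot calculus,
`Re tr(S₀⋯(u·S_i)⋯S₃)` — the derivative of `Re tr ρ(U(∂p))` along the LEFT flow `e^{tu}` of the bond `slotBond p i` — transforms under a rotation `h` at its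
insertion vertex `y = (slotBond p i).src` into the same word with the letter `h⁻¹uh` (§4), and the PAULI TWIRL `u + Σ_{q ∈ {𝐢,𝐣,𝐤}} q⁻¹uq = (2 tr u)·1 = 0`
for traceless `u` (§1) sums the four rotated letters to zero; so against any bounded observable `Φ` INVARIANT under the rotations at `y`,
`4·∫ word·Φ dμ_β = ∫ (Σ_rotations word)·Φ dμ_β = 0` (§2: change of variables ×4 and linearity — no Haar average, no Fubini, no Peter–Weyl).

* §1 ★`pauli_twirl` — for every `X ∈ M₂(ℂ)`: `X + (−𝐢)X𝐢 + (−𝐣)X𝐣 + (−𝐤)X𝐤 = (2·tr X)•1`, the unit quaternions written as explicit matrices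
  (`𝐢 = !![I,0;0,−I]`, `𝐣 = !![0,1;−1,0]`, `𝐤 = !![0,I;I,0]`, inverses `= −q`); `pauli_twirl_eq_zero` for traceless `X`; their membership in `SU(2)`
  (`𝐣`'s is the tree's ✓`SU2ConjugationEven.J_mem`, reused).
* §2 ★★`integral_mul_eq_zero_of_finite_twirl` — ABSTRACT: a finite family `τ_k` of `μ`-preserving maps, `Φ ∘ τ_k = Φ`, `Σ_k Ψ ∘ τ_k = 0`, `Φ, Ψ` bounded
  measurable, `μ` finite ⟹ `∫ Φ·Ψ dμ = 0`.
* §3 ★★`gibbsMeasure_integral_mul_eq_zero_of_siteTwirl` — the instance `τ_k = gaugeAct (y ↦ g_k, 1 elsewhere)` on `gibbsMeasure P β` (`β ≥ 0`), any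
  `[GaugeGroup G]`, any finite family `g : Fin n → G`.
* §4 (letters `slotIns_add`∕`slotIns_congr`∕`word_update_add` = px17's ✓`UnitScaleGibbsWordTwoElitzur`, BY NAME) the gauge law of the one-bond row and ★★★`integral_insWord_mul_eq_zero_of_siteInvariant`:
  `∫ Re tr(word (slot ρ U p)[i ↦ slotIns ρ u U p i]) · Φ(U) dμ_β = 0` whenever `u (slotBond p i)` is traceless and `Φ` is bounded measurable and invariant
  under all rotations at `(slotBond p i).src`; corollary ★`integral_oneBondIns_mul_eq_zero` in the `oneBondDeriv` currency.
HONEST SCOPE.  Exact finite-`β` symmetry identities (infrastructure); they bear on the RAW (undressed) far-field rows of a NOT-YET-RE-LINED variant of LINE 28 and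
prove NOTHING of `stub_linTest`, «ShallowFluxSecondMomentL», (Q), K1, `MeanDeviationL` 23083 ∕ 23133 ∕ 23134, `HistoryTailL`, the rung R3, d = 4, a continuum limit
or a mass gap; the Yang–Mills mass gap is NOT proved.

References: S. Elitzur, Impossibility of spontaneously breaking local symmetries, Phys. Rev. D 12 (1975) 3978 [Elitzur1975]; M. Creutz, Quarks, Gluons and
Lattices (1983∕2022) Ch. 9 [Creutz2022]; A. Wipf, Statistical Approach to Quantum Field Theory (2021) §13.5 [Wipf2021].
-/

set_option autoImplicit false

noncomputable section

open MeasureTheory Filter Topology NormedSpace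
open scoped BigOperators
open Literature.MathematicalPhysics.QuantumFieldTheory.Balaban1983to89
open Literature.MathematicalPhysics.QuantumFieldTheory.Balaban1983to89.T4GenFunBounds (gibbsMeasure isProbabilityMeasure_gibbsMeasure)
open Literature.MathematicalPhysics.QuantumLattice (fundamentalRep fundamentalRep_apply)
open Summit.QuantumFields.YangMills.Theorems.RevelationMartingaleTreeGauge
  (measurePreserving_gaugeAct_gibbsMeasure gaugeAct_single_apply_of_ne gaugeAct_single_apply_of_src gaugeAct_single_apply_of_tgt)
open Summit.QuantumFields.YangMills.Theorems.UnitScaleGibbsActionDerivativeSlotCalculus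
  (slotBond slot slotIns word oneBondDeriv word_update_zero hasDerivAt_wilsonAction4_oneBond continuous_oneBondDeriv)
open Summit.QuantumFields.YangMills.Theorems.UnitScaleGibbsDressedSchwingerDyson (gaugeAct_update_conj)
open Summit.QuantumFields.YangMills.Theorems.UnitScaleGibbsAxialGaugeCondSD (oneBondDeriv_eq_zero_of_apply_eq_zero)
open Summit.QuantumFields.YangMills.Theorems.UnitScaleGibbsOneBondSchwingerDysonMatrix (exists_oneParam_specialUnitaryGroup)
open Summit.QuantumFields.YangMills.Theorems.EquipartitionPinsProbe.TangentSteinFiniteBeta (exists_abs_le_of_continuous)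
open Literature.MathematicalPhysics.QuantumLattice (continuous_fundamentalRep)
open Summit.QuantumFields.YangMills.Theorems.UnitScaleGibbsWordTwoElitzur (slotIns_add slotIns_congr word_update_add)

namespace Summit.QuantumFields.YangMills.Theorems.UnitScaleGibbsElitzurOrthogonality

/-! ## §1 The Pauli twirl: `X + Σ_{q ∈ {𝐢,𝐣,𝐤}} q⁻¹Xq = (2 tr X)•1` -/

section Twirl

open Complex

/-- ★ **THE PAULI TWIRL** on `M₂(ℂ)`: with the unit quaternions `𝐢 = !![I,0;0,−I]`, `𝐣 = !![0,1;−1,0]`, `𝐤 = !![0,I;I,0]` (each with inverse `−q`),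
`X + (−𝐢)X𝐢 + (−𝐣)X𝐣 + (−𝐤)X𝐤 = (2·tr X)•1` for every `X`. [cite: Wipf2021, §13.5] -/
theorem pauli_twirl (X : Matrix (Fin 2) (Fin 2) ℂ) :
    X + (-!![I, 0; 0, -I]) * X * !![I, 0; 0, -I] + (-!![(0 : ℂ), 1; -1, 0]) * X * !![(0 : ℂ), 1; -1, 0]
      + (-!![0, I; I, 0]) * X * !![0, I; I, 0] = (2 * X.trace) • (1 : Matrix (Fin 2) (Fin 2) ℂ) := by
  rw [Matrix.eta_fin_two X]
  simp only [Matrix.trace_fin_two_of, Matrix.neg_of, Matrix.neg_cons, Matrix.neg_empty, neg_neg, neg_zero,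
    Matrix.mul_fin_two, Matrix.of_add_of, Matrix.one_fin_two, Matrix.smul_of, Matrix.smul_cons, Matrix.smul_empty,
    smul_eq_mul]
  ext i j
  fin_cases i <;> fin_cases j <;> simp <;> ring_nf <;> simp only [Complex.I_sq] <;> ring

/-- The Pauli twirl of a TRACELESS matrix vanishes. [cite: Wipf2021, §13.5] -/
theorem pauli_twirl_eq_zero {X : Matrix (Fin 2) (Fin 2) ℂ} (hX : X.trace = 0) :
    X + (-!![I, 0; 0, -I]) * X * !![I, 0; 0, -I] + (-!![(0 : ℂ), 1; -1, 0]) * X * !![(0 : ℂ), 1; -1, 0]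
      + (-!![0, I; I, 0]) * X * !![0, I; I, 0] = 0 := by
  rw [pauli_twirl, hX, mul_zero, zero_smul]

/-- `𝐢 = !![I,0;0,−I] ∈ SU(2)`. [folklore] -/
theorem quatI_mem : !![I, 0; 0, -I] ∈ Matrix.specialUnitaryGroup (Fin 2) ℂ := by
  rw [Matrix.mem_specialUnitaryGroup_iff, Matrix.mem_unitaryGroup_iff]
  refine ⟨?_, ?_⟩
  · rw [Matrix.eta_fin_two (star _)]
    simp [Matrix.star_apply, Matrix.one_fin_two]
  · simp [Matrix.det_fin_two_of]

/-- `𝐤 = !![0,I;I,0] ∈ SU(2)`. [folklore] -/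
theorem quatK_mem : !![0, I; I, 0] ∈ Matrix.specialUnitaryGroup (Fin 2) ℂ := by
  rw [Matrix.mem_specialUnitaryGroup_iff, Matrix.mem_unitaryGroup_iff]
  refine ⟨?_, ?_⟩
  · rw [Matrix.eta_fin_two (star _)]
    simp [Matrix.star_apply, Matrix.one_fin_two]
  · simp [Matrix.det_fin_two_of]

/-- The inverses in `SU(2)` of the three unit quaternions are their negatives (as matrices: `star q = −q`). [folklore] -/
theorem star_quat_eq :
    star (!![I, 0; 0, -I] : Matrix (Fin 2) (Fin 2) ℂ) = -!![I, 0; 0, -I] ∧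
      star (!![(0 : ℂ), 1; -1, 0] : Matrix (Fin 2) (Fin 2) ℂ) = -!![(0 : ℂ), 1; -1, 0] ∧
        star (!![0, I; I, 0] : Matrix (Fin 2) (Fin 2) ℂ) = -!![0, I; I, 0] := by
  refine ⟨?_, ?_, ?_⟩ <;>
  · rw [Matrix.eta_fin_two (star _)]
    simp [Matrix.star_apply]

end Twirl

/-! ## §2 The abstract finite twirl: orthogonality from finitely many measure-preserving symmetries -/

section Abstract

variable {Ω : Type*} [MeasurableSpace Ω] (μ : Measure Ω) [IsFiniteMeasure μ]

/-- ★★ **ORTHOGONALITY FROM A FINITE TWIRL.**  Let `τ_k` (`k < n`, `n ≠ 0`) be measurable `μ`-preserving maps, `Φ` bounded measurable and INVARIANT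
(`Φ ∘ τ_k = Φ`), `Ψ` bounded measurable with `Σ_k Ψ ∘ τ_k = 0` pointwise.  Then `∫ Φ·Ψ dμ = 0`: for each `k`, `∫ Φ·Ψ = ∫ (Φ·Ψ) ∘ τ_k = ∫ Φ·(Ψ ∘ τ_k)`,
and summing over `k` gives `n·∫ Φ·Ψ = ∫ Φ·Σ_k Ψ∘τ_k = 0`.  No Haar average, no Fubini. [cite: Wipf2021, §13.5 (13.80)-(13.81)] -/
theorem integral_mul_eq_zero_of_finite_twirl {n : ℕ} (hn : n ≠ 0) (τ : Fin n → Ω → Ω)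
    (hτ : ∀ k, MeasurePreserving (τ k) μ μ) {Φ Ψ : Ω → ℝ} (hΦm : Measurable Φ) (hΨm : Measurable Ψ)
    {CΦ CΨ : ℝ} (hCΦ : ∀ ω, |Φ ω| ≤ CΦ) (hCΨ : ∀ ω, |Ψ ω| ≤ CΨ)
    (hΦτ : ∀ k ω, Φ (τ k ω) = Φ ω) (hΨτ : ∀ ω, ∑ k, Ψ (τ k ω) = 0) :
    ∫ ω, Φ ω * Ψ ω ∂μ = 0 := by
  -- change of variables along each `τ k`
  have hk : ∀ k, ∫ ω, Φ ω * Ψ ω ∂μ = ∫ ω, Φ ω * Ψ (τ k ω) ∂μ := fun k => by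
    have hm : AEStronglyMeasurable (fun ω => Φ ω * Ψ ω) (Measure.map (τ k) μ) := (hΦm.mul hΨm).aestronglyMeasurable
    have h := integral_map (hτ k).measurable.aemeasurable hm
    rw [(hτ k).map_eq] at h
    rw [h]
    exact integral_congr_ae (ae_of_all _ fun ω => by simp only [hΦτ k ω])
  have hint : ∀ k, Integrable (fun ω => Φ ω * Ψ (τ k ω)) μ := fun k =>
    Integrable.of_bound (hΦm.mul (hΨm.comp (hτ k).measurable)).aestronglyMeasurable (CΦ * CΨ)
      (ae_of_all _ fun ω => by
        rw [Real.norm_eq_abs, abs_mul]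
        exact mul_le_mul (hCΦ ω) (hCΨ _) (abs_nonneg _) ((abs_nonneg _).trans (hCΦ ω)))
  have hsum : (n : ℝ) * ∫ ω, Φ ω * Ψ ω ∂μ = ∫ ω, Φ ω * ∑ k, Ψ (τ k ω) ∂μ := by
    calc (n : ℝ) * ∫ ω, Φ ω * Ψ ω ∂μ = ∑ k : Fin n, ∫ ω, Φ ω * Ψ (τ k ω) ∂μ := by
          rw [Finset.sum_congr rfl fun k _ => (hk k).symm, Finset.sum_const, Finset.card_univ, Fintype.card_fin, nsmul_eq_mul]
      _ = ∫ ω, ∑ k : Fin n, Φ ω * Ψ (τ k ω) ∂μ := (integral_finsetSum _ fun k _ => hint k).symm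
      _ = ∫ ω, Φ ω * ∑ k, Ψ (τ k ω) ∂μ := integral_congr_ae (ae_of_all _ fun ω => by
            show ∑ k, Φ ω * Ψ (τ k ω) = Φ ω * ∑ k, Ψ (τ k ω)
            rw [Finset.mul_sum])
  have h0 : (n : ℝ) * ∫ ω, Φ ω * Ψ ω ∂μ = 0 := by
    rw [hsum]
    simp only [hΨτ, mul_zero, integral_zero]
  rcases mul_eq_zero.1 h0 with h | h
  · exact absurd (by exact_mod_cast h) hn
  · exact h

end Abstract

/-! ## §3 The instance: site rotations of Bałaban's Wilson–Gibbs measure -/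

section Gauge

variable {P : Params} {G : Type} [GaugeGroup G] [MeasurableSpace G] [RegularGaugeGroup G] [HaarData G]

/-- ★★ **ELITZUR ORTHOGONALITY BY A FINITE SITE TWIRL** (any gauge group, `β ≥ 0`).  Let `y` be a site of the finest lattice and `g : Fin n → G` (`n ≠ 0`) a
finite family; write `U^{(k)} := U^{(y ↦ g_k, 1 elsewhere)}` for the site rotations.  If `Φ` is bounded measurable with `Φ(U^{(k)}) = Φ(U)` for all `k`, and
`Ψ` is bounded measurable with `Σ_k Ψ(U^{(k)}) = 0` for every `U`, then `∫ Φ·Ψ dμ_β = 0` — §2 at the `μ_β`-preserving rotations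
(✓`measurePreserving_gaugeAct_gibbsMeasure`). [cite: Elitzur1975, §II; Creutz2022, Ch. 9] -/
theorem gibbsMeasure_integral_mul_eq_zero_of_siteTwirl {β : ℝ} (hβ : 0 ≤ β) (y : Site P 0) {n : ℕ} (hn : n ≠ 0) (g : Fin n → G)
    {Φ Ψ : GaugeField P 0 G → ℝ} (hΦm : Measurable Φ) (hΨm : Measurable Ψ) {CΦ CΨ : ℝ} (hCΦ : ∀ U, |Φ U| ≤ CΦ) (hCΨ : ∀ U, |Ψ U| ≤ CΨ)
    (hΦ : ∀ (k : Fin n) (U : GaugeField P 0 G), Φ (GaugeField.gaugeAct (fun z => if z = y then g k else (1 : G)) U) = Φ U)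
    (hΨ : ∀ U : GaugeField P 0 G, ∑ k, Ψ (GaugeField.gaugeAct (fun z => if z = y then g k else (1 : G)) U) = 0) :
    ∫ U, Φ U * Ψ U ∂gibbsMeasure P β = 0 := by
  haveI := isProbabilityMeasure_gibbsMeasure (G := G) P hβ
  exact integral_mul_eq_zero_of_finite_twirl (gibbsMeasure P β) hn
    (fun k => GaugeField.gaugeAct (fun z => if z = y then g k else (1 : G)))
    (fun k => measurePreserving_gaugeAct_gibbsMeasure P β _) hΦm hΨm hCΦ hCΨ hΦ hΨ

end Gauge


/-! ## §4 The one-bond action rows under a gauge transformation; Elitzur orthogonality of the raw rows (`SU(2)`) -/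

section Slots

variable {N : ℕ} {P : Params} [DecidableEq (PBond P 0)] {G : Type} [GaugeGroup G]
  (ρ : G →* Matrix (Fin N) (Fin N) ℂ)

/-- ★ The one-bond action row `A′_b = oneBondDeriv ρ u b` is ADDITIVE in the test field. [cite: Creutz2022, Ch. 11] -/
theorem oneBondDeriv_add (u w : PBond P 0 → Matrix (Fin N) (Fin N) ℂ) (b : PBond P 0) (U : GaugeField P 0 G) :
    oneBondDeriv ρ (u + w) b U = oneBondDeriv ρ u b U + oneBondDeriv ρ w b U := by
  unfold oneBondDeriv
  rw [← Finset.sum_add_distrib]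
  refine Finset.sum_congr rfl fun p _ => ?_
  rw [← Finset.sum_add_distrib]
  refine Finset.sum_congr rfl fun i _ => ?_
  by_cases hb : slotBond p i = b
  · rw [if_pos hb, if_pos hb, if_pos hb, slotIns_add, word_update_add, Matrix.trace_add, Complex.add_re]
    ring
  · rw [if_neg hb, if_neg hb, if_neg hb, add_zero]

/-- The one-bond action row of `b` reads the test field AT `b` only. [cite: Creutz2022, Ch. 11] -/
theorem oneBondDeriv_congr {u w : PBond P 0 → Matrix (Fin N) (Fin N) ℂ} {b : PBond P 0} (h : u b = w b) (U : GaugeField P 0 G) :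
    oneBondDeriv ρ u b U = oneBondDeriv ρ w b U := by
  unfold oneBondDeriv
  refine Finset.sum_congr rfl fun p _ => Finset.sum_congr rfl fun i _ => ?_
  by_cases hb : slotBond p i = b
  · rw [if_pos hb, if_pos hb, slotIns_congr ρ U p i (by rw [hb, h])]
  · rw [if_neg hb, if_neg hb]

variable {ρ}

/-- ★★ **THE ONE-BOND ACTION ROW UNDER A GAUGE TRANSFORMATION** (matrix model `reTr = Re tr ρ ∕ N`, flows `ρ(k b t) = exp(t u_b)`): for every gauge
transformation `g`, `A′_b[u](U^g) = A′_b[Ad(ρ(g_{·₋})⁻¹)u](U)` — the row at the transformed field is the row at `U` of the test field CONJUGATED AT THE SOURCE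
of each bond.  Proof by uniqueness of derivatives: `A((U^g)[b ↦ k_t (U^g)_b]) = A(U[b ↦ (g_{b₋}⁻¹ k_t g_{b₋}) U_b])` (the dressing identity
✓`gaugeAct_update_conj` + gauge invariance of `A`), both sides being `t`-derivatives at `0` by ✓`hasDerivAt_wilsonAction4_oneBond`, the conjugated family
having generator `ρ(g_{b₋})⁻¹ u_b ρ(g_{b₋})` (`exp_units_conj'`). [cite: Creutz2022, Ch. 9 and Ch. 11] -/
theorem oneBondDeriv_gaugeAct (hre : ∀ g : G, reTr g = (ρ g).trace.re / N) (u : PBond P 0 → Matrix (Fin N) (Fin N) ℂ)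
    {k : PBond P 0 → ℝ → G} (hk : ∀ b s t, k b (s + t) = k b s * k b t) (hkX : ∀ b t, ρ (k b t) = exp ((t : ℂ) • u b))
    (g : GaugeTransf P 0 G) (b : PBond P 0) (U : GaugeField P 0 G) :
    oneBondDeriv ρ u b (GaugeField.gaugeAct g U) =
      oneBondDeriv ρ (fun b' => ρ ((g b'.src)⁻¹) * u b' * ρ (g b'.src)) b U := by
  -- the conjugated family and its generator
  set k' : PBond P 0 → ℝ → G := fun b' t => (g b'.src)⁻¹ * k b' t * g b'.src with hk'def
  have hk' : ∀ b' s t, k' b' (s + t) = k' b' s * k' b' t := fun b' s t => by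
    simp only [hk'def, hk]
    simp only [mul_assoc, mul_inv_cancel_left]
  have hkX' : ∀ b' t, ρ (k' b' t) = exp ((t : ℂ) • (ρ ((g b'.src)⁻¹) * u b' * ρ (g b'.src))) := fun b' t => by
    have hinv1 : ρ (g b'.src) * ρ ((g b'.src)⁻¹) = 1 := by rw [← map_mul, mul_inv_cancel, map_one]
    have hinv2 : ρ ((g b'.src)⁻¹) * ρ (g b'.src) = 1 := by rw [← map_mul, inv_mul_cancel, map_one]
    let Pu : (Matrix (Fin N) (Fin N) ℂ)ˣ := ⟨ρ (g b'.src), ρ ((g b'.src)⁻¹), hinv1, hinv2⟩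
    have hc := Matrix.exp_units_conj' Pu ((t : ℂ) • u b')
    have hPu : (Pu : Matrix (Fin N) (Fin N) ℂ) = ρ (g b'.src) := rfl
    have hPu' : ((Pu⁻¹ : (Matrix (Fin N) (Fin N) ℂ)ˣ) : Matrix (Fin N) (Fin N) ℂ) = ρ ((g b'.src)⁻¹) := rfl
    rw [hPu, hPu'] at hc
    rw [hk'def]
    dsimp only
    rw [map_mul, map_mul, hkX, ← hc, Matrix.mul_smul, Matrix.smul_mul]
  -- both rows are derivatives at `0` of the same function of `t`
  have h1 := hasDerivAt_wilsonAction4_oneBond hre hk hkX b (GaugeField.gaugeAct g U)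
  have h2 := hasDerivAt_wilsonAction4_oneBond hre hk' hkX' b U
  have hfun : (fun t : ℝ => wilsonAction4 (Function.update (GaugeField.gaugeAct g U) b (k b t * GaugeField.gaugeAct g U b))) =
      fun t : ℝ => wilsonAction4 (Function.update U b (k' b t * U b)) := by
    funext t
    rw [← gaugeAct_update_conj g U b (k b t)]
    show wilsonAction 1 _ = wilsonAction 1 _
    rw [T4WilsonGaugeFlatDirection.wilsonAction_gaugeAct]
  rw [hfun] at h1
  exact h1.unique h2

end Slots

section SpecialUnitary

open Complex

variable {P : Params} [DecidableEq (PBond P 0)]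

omit [DecidableEq (PBond P 0)] in
/-- Conjugating by a site rotation at `y`: at a bond issuing from `y` the letter becomes `h⋆·v·h`, elsewhere it is unchanged. [folklore] -/
theorem conj_siteRot_apply (y : Site P 0) (h : Matrix.specialUnitaryGroup (Fin 2) ℂ) (v : PBond P 0 → Matrix (Fin 2) (Fin 2) ℂ)
    (b' : PBond P 0) :
    fundamentalRep (Fin 2) (((fun z : Site P 0 => if z = y then h else (1 : Matrix.specialUnitaryGroup (Fin 2) ℂ)) b'.src)⁻¹) * v b' *
        fundamentalRep (Fin 2) ((fun z : Site P 0 => if z = y then h else (1 : Matrix.specialUnitaryGroup (Fin 2) ℂ)) b'.src) =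
      if b'.src = y then star (h : Matrix (Fin 2) (Fin 2) ℂ) * v b' * (h : Matrix (Fin 2) (Fin 2) ℂ) else v b' := by
  by_cases hb : b'.src = y
  · simp only [hb, if_true, fundamentalRep_apply]
    rfl
  · simp only [hb, if_false, inv_one, map_one, one_mul, mul_one]

/-- ★★★ **ELITZUR ORTHOGONALITY OF THE RAW ONE-BOND ACTION ROWS** (`SU(2)`, `β ≥ 0`, every volume).  For a test field `u` with values in 𝔰𝔲(2)
(skew-Hermitian, traceless) and a finest bond `b`, the RAW one-bond row `A′_b = oneBondDeriv (fundamentalRep (Fin 2)) u b` — the first-insertion words of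
the four plaquettes through `b`, all inserted AT THE VERTEX `b.src` — is `μ_β`-orthogonal to every bounded measurable observable `Φ` that is invariant under
the gauge rotations at `b.src`: `∫ Φ·A′_b dμ_β = 0`.  (Rotating at `b.src` by the unit quaternions conjugates the letter `u_b` (`oneBondDeriv_gaugeAct`); the four
conjugates sum to `(2 tr u_b)·1 = 0` (`pauli_twirl`); the row is additive in the letter and vanishes for the zero letter; §3.)  In particular `A′_b` is
orthogonal to every raw row `A′_{b'}` with `b'.src ≠ b.src` touching no bond at `b.src`, and to every observable DRESSED by the axial gauge of a box not
containing `b.src`. [cite: Elitzur1975, §II; Creutz2022, Ch. 9] -/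
theorem integral_mul_oneBondDeriv_eq_zero_of_siteInvariant {β : ℝ} (hβ : 0 ≤ β)
    (u : PBond P 0 → Matrix (Fin 2) (Fin 2) ℂ) (hu : ∀ b, star (u b) = -(u b) ∧ (u b).trace = 0) (b : PBond P 0)
    {Φ : GaugeField P 0 (Matrix.specialUnitaryGroup (Fin 2) ℂ) → ℝ} (hΦm : Measurable Φ) {C : ℝ} (hC : ∀ U, |Φ U| ≤ C)
    (hΦ : ∀ (h : Matrix.specialUnitaryGroup (Fin 2) ℂ) (U : GaugeField P 0 (Matrix.specialUnitaryGroup (Fin 2) ℂ)),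
      Φ (GaugeField.gaugeAct (fun z => if z = b.src then h else (1 : Matrix.specialUnitaryGroup (Fin 2) ℂ)) U) = Φ U) :
    ∫ U, Φ U * oneBondDeriv (fundamentalRep (Fin 2)) u b U ∂gibbsMeasure P β = 0 := by
  haveI : SecondCountableTopology (Matrix.specialUnitaryGroup (Fin 2) ℂ) := by
    haveI := secondCountableTopology_matrix (n := Fin 2)
    exact Topology.IsEmbedding.subtypeVal.secondCountableTopology
  haveI : CompactSpace (GaugeField P 0 (Matrix.specialUnitaryGroup (Fin 2) ℂ)) :=
    inferInstanceAs (CompactSpace (PBond P 0 → Matrix.specialUnitaryGroup (Fin 2) ℂ))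
  haveI : OpensMeasurableSpace (GaugeField P 0 (Matrix.specialUnitaryGroup (Fin 2) ℂ)) :=
    inferInstanceAs (OpensMeasurableSpace (PBond P 0 → Matrix.specialUnitaryGroup (Fin 2) ℂ))
  -- the matrix-model data of `SU(2)`
  have hre : ∀ g : Matrix.specialUnitaryGroup (Fin 2) ℂ, reTr g = (fundamentalRep (Fin 2) g).trace.re / (2 : ℕ) := fun g => by
    show UnitaryModel.nReTr (g : Matrix (Fin 2) (Fin 2) ℂ) = _
    simp [UnitaryModel.nReTr, Fintype.card_fin]
  choose k hk hkX using fun b' => exists_oneParam_specialUnitaryGroup (hu b').1 (hu b').2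
  -- the row is continuous, hence bounded measurable
  have hΨc : Continuous (oneBondDeriv (fundamentalRep (Fin 2)) u b :
      GaugeField P 0 (Matrix.specialUnitaryGroup (Fin 2) ℂ) → ℝ) := continuous_oneBondDeriv (continuous_fundamentalRep (Fin 2)) u b
  obtain ⟨CΨ, -, hCΨ⟩ := exists_abs_le_of_continuous hΨc
  -- the four rotations `1, 𝐢, 𝐣, 𝐤`
  let q : Fin 4 → Matrix.specialUnitaryGroup (Fin 2) ℂ :=
    ![1, ⟨!![I, 0; 0, -I], quatI_mem⟩, ⟨!![(0 : ℂ), 1; -1, 0], FiniteSusceptibilityWeakCoupling.SU2ConjugationEven.J_mem⟩, ⟨!![0, I; I, 0], quatK_mem⟩]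
  refine gibbsMeasure_integral_mul_eq_zero_of_siteTwirl hβ b.src (n := 4) (by norm_num) q hΦm hΨc.measurable hC hCΨ
    (fun j U => hΦ (q j) U) fun U => ?_
  -- the rotated rows are the rows of the conjugated letters …
  have hrot : ∀ j : Fin 4, oneBondDeriv (fundamentalRep (Fin 2)) u b
      (GaugeField.gaugeAct (fun z => if z = b.src then q j else (1 : Matrix.specialUnitaryGroup (Fin 2) ℂ)) U) =
      oneBondDeriv (fundamentalRep (Fin 2))
        (fun b' => if b'.src = b.src then star (q j : Matrix (Fin 2) (Fin 2) ℂ) * u b' * (q j : Matrix (Fin 2) (Fin 2) ℂ) else u b') b U :=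
    fun j => by
      rw [oneBondDeriv_gaugeAct hre u hk hkX]
      exact oneBondDeriv_congr _ (by rw [conj_siteRot_apply]) U
  simp only [hrot]
  -- … which sum to the row of the Pauli twirl of `u_b`, i.e. of `0`
  rw [Fin.sum_univ_four, ← oneBondDeriv_add, ← oneBondDeriv_add, ← oneBondDeriv_add]
  refine oneBondDeriv_eq_zero_of_apply_eq_zero _ _ ?_ U
  obtain ⟨hqI, hqJ, hqK⟩ := star_quat_eq
  simp only [Pi.add_apply, if_true, q, Matrix.cons_val_zero, Matrix.cons_val_one, Matrix.head_cons, Matrix.cons_val_two,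
    Matrix.tail_cons, Matrix.cons_val_three, OneMemClass.coe_one, star_one, one_mul, mul_one, hqI, hqJ, hqK]
  exact pauli_twirl_eq_zero (hu b).2

/-- The same orthogonality with the factors commuted: `∫ A′_b·Φ dμ_β = 0`. [cite: Elitzur1975, §II] -/
theorem integral_oneBondDeriv_mul_eq_zero_of_siteInvariant {β : ℝ} (hβ : 0 ≤ β)
    (u : PBond P 0 → Matrix (Fin 2) (Fin 2) ℂ) (hu : ∀ b, star (u b) = -(u b) ∧ (u b).trace = 0) (b : PBond P 0)
    {Φ : GaugeField P 0 (Matrix.specialUnitaryGroup (Fin 2) ℂ) → ℝ} (hΦm : Measurable Φ) {C : ℝ} (hC : ∀ U, |Φ U| ≤ C)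
    (hΦ : ∀ (h : Matrix.specialUnitaryGroup (Fin 2) ℂ) (U : GaugeField P 0 (Matrix.specialUnitaryGroup (Fin 2) ℂ)),
      Φ (GaugeField.gaugeAct (fun z => if z = b.src then h else (1 : Matrix.specialUnitaryGroup (Fin 2) ℂ)) U) = Φ U) :
    ∫ U, oneBondDeriv (fundamentalRep (Fin 2)) u b U * Φ U ∂gibbsMeasure P β = 0 := by
  rw [← integral_mul_oneBondDeriv_eq_zero_of_siteInvariant hβ u hu b hΦm hC hΦ]
  exact integral_congr_ae (ae_of_all _ fun U => mul_comm _ _)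

end SpecialUnitary

end Summit.QuantumFields.YangMills.Theorems.UnitScaleGibbsElitzurOrthogonality

end
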